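import Literature.NumberTheory.GaloisRepresentations.GaloisCohomologyScalarAction
import Literature.NumberTheory.GaloisRepresentations.ContinuousCohomologyConnecting
import Literature.NumberTheory.GaloisRepresentations.AbsGaloisGroupCompact
import HarnessLib

/-!
# The scalar action on `H²(K, M)` of an `R`-linear discrete Galois module: ring axioms (theorems only)

`Proofs` file (theorems only; no definition, no named fact, no instance, no `sorry`).  Topic
`NumberTheory/GaloisRepresentations`; namespace `Literature.NumberTheory.GaloisRepresentations.galoisCohomology`.
Degree-`2` companion of §3 of `GaloisCohomologyScalarAction` (which proves the ring axioms of the functorial scalar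
action `H¹(r•) = galoisCohomology.scalarMapH1` through explicit crossed homomorphisms): for an `R`-linear discrete
Galois module `ρ` (`DiscreteGaloisModule.IsScalarLinear`) the endomorphisms
`H²(r•) = galoisCohomology.scalarMap ρ hρ 2 r` of `H²(K, M)` satisfy

* `scalarMap_two_twoCocycleClass` — on explicit inhomogeneous `2`-cocycles `H²(r•)[c] = [r ∘ c]`
  (`(r ∘ c)(σ, τ) = r • c(σ, τ)`; Mathlib/tree `cohomologyMap_twoCocycleClass`);
* `scalarMap_two_one`, `scalarMap_two_mul` (`H²((rs)•) = H²(r•) ∘ H²(s•)`), `scalarMap_two_pow_apply` (iterates), `scalarMap_two_add`,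
  `scalarMap_two_zero`, `scalarMap_two_neg`, `scalarMap_two_sub`, `scalarMap_two_intCast` / `scalarMap_two_natCast`
  (`H²((n : R)•) = n •`), and the vanishing criteria `scalarMap_two_eq_zero_of_forall_smul_eq_zero` (a scalar killing
  the module kills `H²`) / `scalarMap_two_pow_eq_zero_of_forall_pow_smul_eq_zero`;
* `scalarMap_two_eq_neg_pow_of_add_eq_zero` — the Eisenstein relation: if `π^m • x + (p : ℤ) • x = 0` on `M` then
  `p • z = −H²(π•)^m z` on `H²(K, M)` (so `p H² ⊆ [π] H²`, the input of the finite-`p`-group annihilation lemma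
  `iterate_apply_eq_zero_of_natCard_le_pow` of `ZpExtensionEisensteinPiLevelCountProofs`).

All by `twoCocycleClass_surjective` + `cohomologyMap_twoCocycleClass` + pointwise identities of cocycles.  Used on the
uniform «`ι` on the characteristic-`p` level» road for Howard's H.5(b) at `v ∣ p` (cell `pub/bsd-print-x9`): the
hypotheses «`[T]^c` kills `H²(K_w, ·)`» of `TowerEndomorphismKernelLiftProofs` are `scalarMap … 2 ([T]^c) = 0`, obtained
from a COUNT of `H²` and the relation `p = −[T]^m`.  Everything here is [folklore]: Serre, *Galois Cohomology* (1997),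
I §2.2 (functoriality of `Hⁿ(G, A)` in `A`), I §2.3 (`H²` by factor systems); NSW (2008), (1.5.1).  No summit statement
is proved; BSD is not proved by any of this.
-/

noncomputable section

open CategoryTheory
open scoped ContRepresentation

universe u v

namespace Literature.NumberTheory.GaloisRepresentations

namespace galoisCohomology

open DiscreteGaloisModule Field

variable {K : Type u} [Field K] {M : Type u} [AddCommGroup M] [TopologicalSpace M] [DiscreteTopology M]
  {R : Type v} [Ring R] [Module R M] (ρ : DiscreteGaloisModule K M) (hρ : ρ.IsScalarLinear R)

/-! ## §1 `H²(r•)` on explicit `2`-cocycles -/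

/-- **`H²(r•)[c] = [r ∘ c]`**: the functorial scalar action in degree `2` on the class of a continuous inhomogeneous
`2`-cocycle `c` is the class of the pulled-back cocycle `(σ, τ) ↦ r • c(σ, τ)` (tree `cohomologyMap_twoCocycleClass`).
[cite: SerreGaloisCohomology1997, Ch. I §2.2 (functoriality of Hⁿ(G, A) in A) and §2.3 (H² via factor systems)] -/
theorem scalarMap_two_twoCocycleClass [LocallyCompactSpace (absoluteGaloisGroup K)] (r : R)
    (c : contTwoCocycles ρ.toTopRep) :
    scalarMap ρ hρ 2 r (twoCocycleClass ρ.toTopRep c) =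
      twoCocycleClass ρ.toTopRep
        (contTwoCocycles.pullback (ContinuousMonoidHom.id (absoluteGaloisGroup K)) (X := ρ.toTopRep) (Y := ρ.toTopRep)
          (resIdHom (TopRep.ofHom ⟨(scalarIntertwining ρ hρ r).toContinuousLinearMap,
            (scalarIntertwining ρ hρ r).isIntertwining'⟩ : ρ.toTopRep ⟶ ρ.toTopRep))
          c) :=
  cohomologyMap_twoCocycleClass _ c

/-- The pulled-back cocycle is `(σ, τ) ↦ r • c(σ, τ)` pointwise. [cite: SerreGaloisCohomology1997, Ch. I §2.2–2.3] -/
theorem pullback_scalarIntertwining_apply [LocallyCompactSpace (absoluteGaloisGroup K)] (r : R)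
    (c : contTwoCocycles ρ.toTopRep) (σ τ : absoluteGaloisGroup K) :
    (contTwoCocycles.pullback (ContinuousMonoidHom.id (absoluteGaloisGroup K)) (X := ρ.toTopRep) (Y := ρ.toTopRep)
        (resIdHom (TopRep.ofHom ⟨(scalarIntertwining ρ hρ r).toContinuousLinearMap,
          (scalarIntertwining ρ hρ r).isIntertwining'⟩ : ρ.toTopRep ⟶ ρ.toTopRep))
        c).1 (σ, τ) = r • c.1 (σ, τ) := rfl

/-! ## §2 Ring axioms for `H²(r•)` -/

/-- `H²(1•) = id`. [cite: SerreGaloisCohomology1997, Ch. I §2.2 (functoriality of Hⁿ(G, A) in A)] -/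
theorem scalarMap_two_one : scalarMap ρ hρ 2 1 = AddMonoidHom.id _ := by
  haveI : CompactSpace (absoluteGaloisGroup K) := absoluteGaloisGroup_compactSpace K
  refine AddMonoidHom.ext fun z ↦ ?_
  obtain ⟨c, rfl⟩ := twoCocycleClass_surjective ρ.toTopRep z
  rw [scalarMap_two_twoCocycleClass, AddMonoidHom.id_apply]
  congr 1
  exact Subtype.ext (ContinuousMap.ext fun g ↦ by
    obtain ⟨σ, τ⟩ := g
    rw [pullback_scalarIntertwining_apply, one_smul])

/-- **`H²((r s)•) = H²(r•) ∘ H²(s•)`**. [cite: SerreGaloisCohomology1997, Ch. I §2.2 (functoriality of Hⁿ(G, A) in A)] -/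
theorem scalarMap_two_mul (r s : R) :
    scalarMap ρ hρ 2 (r * s) = (scalarMap ρ hρ 2 r).comp (scalarMap ρ hρ 2 s) := by
  haveI : CompactSpace (absoluteGaloisGroup K) := absoluteGaloisGroup_compactSpace K
  refine AddMonoidHom.ext fun z ↦ ?_
  obtain ⟨c, rfl⟩ := twoCocycleClass_surjective ρ.toTopRep z
  rw [AddMonoidHom.comp_apply, scalarMap_two_twoCocycleClass, scalarMap_two_twoCocycleClass,
    scalarMap_two_twoCocycleClass]
  congr 1
  exact Subtype.ext (ContinuousMap.ext fun g ↦ by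
    obtain ⟨σ, τ⟩ := g
    rw [pullback_scalarIntertwining_apply, pullback_scalarIntertwining_apply, pullback_scalarIntertwining_apply,
      mul_smul])

/-- `H²((r s)•) z = H²(r•) (H²(s•) z)`. [cite: SerreGaloisCohomology1997, Ch. I §2.2] -/
theorem scalarMap_two_mul_apply (r s : R) (z : galoisCohomology ρ 2) :
    scalarMap ρ hρ 2 (r * s) z = scalarMap ρ hρ 2 r (scalarMap ρ hρ 2 s z) := by
  rw [scalarMap_two_mul, AddMonoidHom.comp_apply]

/-- **`H²((r^k)•) z = (H²(r•))^[k] z`** (powers of the scalar act as iterates). [cite: SerreGaloisCohomology1997, Ch. I §2.2 (functoriality of Hⁿ(G, A) in A)] -/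
theorem scalarMap_two_pow_apply (r : R) (k : ℕ) (z : galoisCohomology ρ 2) :
    scalarMap ρ hρ 2 (r ^ k) z = (scalarMap ρ hρ 2 r)^[k] z := by
  induction k generalizing z with
  | zero =>
    rw [pow_zero, Function.iterate_zero, id_eq, scalarMap_two_one, AddMonoidHom.id_apply]
  | succ k ih =>
    rw [pow_succ, scalarMap_two_mul_apply, Function.iterate_succ_apply', ← ih]
    rw [← scalarMap_two_mul_apply, ← scalarMap_two_mul_apply, ← pow_succ, ← pow_succ']

/-- **Additivity in the scalar**: `H²((r + s)•) = H²(r•) + H²(s•)`.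
[cite: SerreGaloisCohomology1997, Ch. I §2.2 (functoriality of Hⁿ(G, A) in A)] -/
theorem scalarMap_two_add (r s : R) :
    scalarMap ρ hρ 2 (r + s) = scalarMap ρ hρ 2 r + scalarMap ρ hρ 2 s := by
  haveI : CompactSpace (absoluteGaloisGroup K) := absoluteGaloisGroup_compactSpace K
  refine AddMonoidHom.ext fun z ↦ ?_
  obtain ⟨c, rfl⟩ := twoCocycleClass_surjective ρ.toTopRep z
  rw [AddMonoidHom.add_apply, scalarMap_two_twoCocycleClass, scalarMap_two_twoCocycleClass,
    scalarMap_two_twoCocycleClass]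
  have hc : contTwoCocycles.pullback (ContinuousMonoidHom.id (absoluteGaloisGroup K)) (X := ρ.toTopRep)
      (Y := ρ.toTopRep) (resIdHom (TopRep.ofHom ⟨(scalarIntertwining ρ hρ (r + s)).toContinuousLinearMap,
        (scalarIntertwining ρ hρ (r + s)).isIntertwining'⟩ : ρ.toTopRep ⟶ ρ.toTopRep)) c =
      contTwoCocycles.pullback (ContinuousMonoidHom.id (absoluteGaloisGroup K)) (X := ρ.toTopRep)
        (Y := ρ.toTopRep) (resIdHom (TopRep.ofHom ⟨(scalarIntertwining ρ hρ r).toContinuousLinearMap,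
          (scalarIntertwining ρ hρ r).isIntertwining'⟩ : ρ.toTopRep ⟶ ρ.toTopRep)) c +
      contTwoCocycles.pullback (ContinuousMonoidHom.id (absoluteGaloisGroup K)) (X := ρ.toTopRep)
        (Y := ρ.toTopRep) (resIdHom (TopRep.ofHom ⟨(scalarIntertwining ρ hρ s).toContinuousLinearMap,
          (scalarIntertwining ρ hρ s).isIntertwining'⟩ : ρ.toTopRep ⟶ ρ.toTopRep)) c :=
    Subtype.ext (ContinuousMap.ext fun g ↦ by
      obtain ⟨σ, τ⟩ := g
      rw [pullback_scalarIntertwining_apply, add_smul]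
      rfl)
  rw [hc, twoCocycleClass_add]
  rfl

/-- `H²(0•) = 0`. [cite: SerreGaloisCohomology1997, Ch. I §2.2 (functoriality of Hⁿ(G, A) in A)] -/
theorem scalarMap_two_zero : scalarMap ρ hρ 2 0 = 0 := by
  haveI : CompactSpace (absoluteGaloisGroup K) := absoluteGaloisGroup_compactSpace K
  refine AddMonoidHom.ext fun z ↦ ?_
  obtain ⟨c, rfl⟩ := twoCocycleClass_surjective ρ.toTopRep z
  rw [AddMonoidHom.zero_apply, scalarMap_two_twoCocycleClass]
  have hc : contTwoCocycles.pullback (ContinuousMonoidHom.id (absoluteGaloisGroup K)) (X := ρ.toTopRep)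
      (Y := ρ.toTopRep) (resIdHom (TopRep.ofHom ⟨(scalarIntertwining ρ hρ (0 : R)).toContinuousLinearMap,
        (scalarIntertwining ρ hρ (0 : R)).isIntertwining'⟩ : ρ.toTopRep ⟶ ρ.toTopRep)) c = 0 :=
    Subtype.ext (ContinuousMap.ext fun g ↦ by
      obtain ⟨σ, τ⟩ := g
      rw [pullback_scalarIntertwining_apply, zero_smul]
      rfl)
  rw [hc, twoCocycleClass_zero]
  rfl

/-- `H²((−r)•) = −H²(r•)`. [cite: SerreGaloisCohomology1997, Ch. I §2.2 (functoriality of Hⁿ(G, A) in A)] -/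
theorem scalarMap_two_neg (r : R) : scalarMap ρ hρ 2 (-r) = -scalarMap ρ hρ 2 r := by
  rw [eq_neg_iff_add_eq_zero, ← scalarMap_two_add, neg_add_cancel, scalarMap_two_zero]

/-- `H²((r − s)•) = H²(r•) − H²(s•)`. [cite: SerreGaloisCohomology1997, Ch. I §2.2 (functoriality of Hⁿ(G, A) in A)] -/
theorem scalarMap_two_sub (r s : R) :
    scalarMap ρ hρ 2 (r - s) = scalarMap ρ hρ 2 r - scalarMap ρ hρ 2 s := by
  rw [sub_eq_add_neg, scalarMap_two_add, scalarMap_two_neg, sub_eq_add_neg]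

/-- **`H²((n : R)•) z = n • z` for an integer `n`** (on integers the functorial action is the `ℤ`-structure of the
group `H²(K, M)`). [cite: SerreGaloisCohomology1997, Ch. I §2.2 (functoriality of Hⁿ(G, A) in A)] -/
theorem scalarMap_two_intCast (n : ℤ) (z : galoisCohomology ρ 2) :
    scalarMap ρ hρ 2 (n : R) z = n • z := by
  haveI : CompactSpace (absoluteGaloisGroup K) := absoluteGaloisGroup_compactSpace K
  obtain ⟨c, rfl⟩ := twoCocycleClass_surjective ρ.toTopRep z
  rw [scalarMap_two_twoCocycleClass]
  have hc : contTwoCocycles.pullback (ContinuousMonoidHom.id (absoluteGaloisGroup K)) (X := ρ.toTopRep)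
      (Y := ρ.toTopRep) (resIdHom (TopRep.ofHom ⟨(scalarIntertwining ρ hρ (n : R)).toContinuousLinearMap,
        (scalarIntertwining ρ hρ (n : R)).isIntertwining'⟩ : ρ.toTopRep ⟶ ρ.toTopRep)) c = n • c :=
    Subtype.ext (ContinuousMap.ext fun g ↦ by
      obtain ⟨σ, τ⟩ := g
      rw [pullback_scalarIntertwining_apply, Int.cast_smul_eq_zsmul]
      rfl)
  rw [hc]
  exact map_zsmul (twoCocycleClassₗ ρ.toTopRep) n c

/-- `H²((n : R)•) z = n • z` for a natural number `n`. [cite: SerreGaloisCohomology1997, Ch. I §2.2] -/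
theorem scalarMap_two_natCast (n : ℕ) (z : galoisCohomology ρ 2) :
    scalarMap ρ hρ 2 (n : R) z = n • z := by
  haveI : CompactSpace (absoluteGaloisGroup K) := absoluteGaloisGroup_compactSpace K
  rw [← Int.cast_natCast, scalarMap_two_intCast, natCast_zsmul]

/-! ## §3 Vanishing criteria and the Eisenstein relation -/

/-- **A scalar killing the module kills `H²`**: `r • M = 0 ⇒ H²(r•) = 0` (degree-`2` twin of
`Tower.scalarMapH1_eq_zero_of_forall`). [cite: SerreGaloisCohomology1997, Ch. I §2.2 (functoriality of Hⁿ(G, A) in A)] -/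
theorem scalarMap_two_eq_zero_of_forall_smul_eq_zero (r : R) (hr : ∀ m : M, r • m = 0) (z : galoisCohomology ρ 2) :
    scalarMap ρ hρ 2 r z = 0 := by
  haveI : CompactSpace (absoluteGaloisGroup K) := absoluteGaloisGroup_compactSpace K
  obtain ⟨c, rfl⟩ := twoCocycleClass_surjective ρ.toTopRep z
  rw [scalarMap_two_twoCocycleClass]
  have hc : contTwoCocycles.pullback (ContinuousMonoidHom.id (absoluteGaloisGroup K)) (X := ρ.toTopRep)
      (Y := ρ.toTopRep) (resIdHom (TopRep.ofHom ⟨(scalarIntertwining ρ hρ r).toContinuousLinearMap,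
        (scalarIntertwining ρ hρ r).isIntertwining'⟩ : ρ.toTopRep ⟶ ρ.toTopRep)) c = 0 :=
    Subtype.ext (ContinuousMap.ext fun g ↦ by
      obtain ⟨σ, τ⟩ := g
      rw [pullback_scalarIntertwining_apply, hr]
      rfl)
  rw [hc, twoCocycleClass_zero]
  rfl

/-- **A nilpotent scalar acts nilpotently on `H²`**: `r^k • M = 0 ⇒ H²(r•)^[k] = 0`.
[cite: SerreGaloisCohomology1997, Ch. I §2.2 (functoriality of Hⁿ(G, A) in A)] -/
theorem scalarMap_two_pow_eq_zero_of_forall_pow_smul_eq_zero (r : R) (k : ℕ) (hr : ∀ m : M, r ^ k • m = 0)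
    (z : galoisCohomology ρ 2) : (scalarMap ρ hρ 2 r)^[k] z = 0 := by
  rw [← scalarMap_two_pow_apply]
  exact scalarMap_two_eq_zero_of_forall_smul_eq_zero ρ hρ (r ^ k) hr z

/-- **The Eisenstein relation on `H²`**: if `π^m • x + (p : ℤ) • x = 0` for all `x ∈ M` (`p = −π^m` on the module, as
on Howard's levels `A_{m,k}`-modules, `T^m + p = 0`), then `(p : ℤ) • z = −H²(π•)^[m] z` on `H²(K, M)` — in
particular `p • H² ⊆ H²(π•)(H²)`. [cite: SerreGaloisCohomology1997, Ch. I §2.2] [cite: Howard2004HeegnerKolyvagin, §2.2 and proof of Thm. 2.2.10 (𝔮 = T^m + p)] -/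
theorem zsmul_eq_neg_iterate_scalarMap_two_of_forall (π : R) (m : ℕ) (p : ℤ)
    (hπ : ∀ x : M, π ^ m • x + p • x = 0) (z : galoisCohomology ρ 2) :
    p • z = -((scalarMap ρ hρ 2 π)^[m] z) := by
  rw [← scalarMap_two_pow_apply, ← scalarMap_two_intCast ρ hρ p z, eq_neg_iff_add_eq_zero, add_comm,
    ← AddMonoidHom.add_apply, ← scalarMap_two_add]
  exact scalarMap_two_eq_zero_of_forall_smul_eq_zero ρ hρ _ (fun x ↦ by rw [add_smul, Int.cast_smul_eq_zsmul]; exact hπ x)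
    z

/-- Hence **`p • z ∈ range H²(π•)`** under the Eisenstein relation (`m ≥ 1`): the hypothesis «`pM ⊆ φ M`» of the
finite-`p`-group annihilation argument, for `φ = H²(π•)` on `H²(K, M)`.
[cite: SerreGaloisCohomology1997, Ch. I §2.2] [cite: Howard2004HeegnerKolyvagin, §2.2 and proof of Thm. 2.2.10 (𝔮 = T^m + p)] -/
theorem exists_scalarMap_two_eq_zsmul_of_forall (π : R) {m : ℕ} (hm : 1 ≤ m) (p : ℤ)
    (hπ : ∀ x : M, π ^ m • x + p • x = 0) (z : galoisCohomology ρ 2) :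
    ∃ y : galoisCohomology ρ 2, scalarMap ρ hρ 2 π y = p • z := by
  obtain ⟨m', rfl⟩ := Nat.exists_eq_add_of_le' hm
  refine ⟨-((scalarMap ρ hρ 2 π)^[m'] z), ?_⟩
  rw [map_neg, zsmul_eq_neg_iterate_scalarMap_two_of_forall ρ hρ π (m' + 1) p hπ z, Function.iterate_succ_apply']

end galoisCohomology

end Literature.NumberTheory.GaloisRepresentations

end
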